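import Summits.CriticalPhenomena.SAWScalingLimit.Theorems.SAWRenewalTightnessTightIdentificationGlue
import Summits.CriticalPhenomena.SAWScalingLimit.Theses.SAWTotalPositivity

/-!
# Route `SAWTotalPositivity`: the assembly frame

Item `stmt-CriticalPhenomena-10783` (`Assembly : BoundaryTP2 → CriticalBubbleBound →
TPToTraversalBound → TraversalBoundTight → SubseqIdentification → SAWScalingLimit`).

Pure logic down to the last step: `TPToTraversalBound` applied to `BoundaryTP2` and
`CriticalBubbleBound` gives `SAWTraversalBound` (the Aizenman–Burchard hypothesis (H1) for the
critical square-lattice SAW); `TraversalBoundTight` turns it into `EventualTight` (tightness of the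
critical SAW curve laws along the mesh, `IsTightAlongMesh`); and for each Dobrushin domain with an
endpoint approximation the tree's PROVED Prokhorov/Billingsley criterion for the SAW,
`saw_convergesInLawToSLE_of_isTightAlongMesh` (`SAWRenewalTightnessTightIdentificationGlue.lean`:
the laws are probability measures for all small `δ`, the curve observable is measurable, uniqueness
of the chordal SLE_{8/3} law), fed with `SubseqIdentification` read through `IsSubseqLimitLaw`,
yields `ConvergesInLawToSLE (8/3)`, i.e. the conjunct `SAWScalingLimit`.

## References

* P. Billingsley, *Convergence of Probability Measures*, 2nd ed. (1999), Thm. 5.1 and its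
  Corollary [BillingsleyCPM1999].
-/

noncomputable section

namespace Summit.CriticalPhenomena.SAWScalingLimit.Theorems

/-- **Item `stmt-CriticalPhenomena-10783` (`SAWTotalPositivity.Assembly`):
`BoundaryTP2 → CriticalBubbleBound → TPToTraversalBound → TraversalBoundTight →
SubseqIdentification → SAWScalingLimit`.** Modus ponens twice (`TPToTraversalBound` on the two
cruxes gives `SAWTraversalBound`, `TraversalBoundTight` gives `EventualTight`), then for each
`(D, a, b)` with `IsEndpointApprox` the SAW convergence criterion
`saw_convergesInLawToSLE_of_isTightAlongMesh` with the subsequential limit laws identified by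
`SubseqIdentification`. [cite: BillingsleyCPM1999, Thm. 5.1, Corollary] -/
theorem totalPositivity_assembly_proof : Theses.SAWTotalPositivity.Assembly := by
  unfold Theses.SAWTotalPositivity.Assembly
  intro hTP hB hE hTT hI D a b hab
  have hTrav : Theses.SAWTotalPositivity.SAWTraversalBound := hE hTP hB
  have hT : Theses.SAWTotalPositivity.EventualTight := hTT hTrav
  refine saw_convergesInLawToSLE_of_isTightAlongMesh hab (hT D a b hab) ?_
  rintro μ hμ ⟨s, hs, hlim⟩
  exact hI D a b hab s μ hs hμ hlim

end Summit.CriticalPhenomena.SAWScalingLimit.Theorems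

end
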